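/-
Copyright (c) 2026 the pub-hodgecm-mathlib formalisation cell (harness21).  Prover seat hodgecm-mathlib-B-p14 (g36): road «S3-tree» (LEAD F0P3a-plan (g11), architect A-p16 (g29)),
brick T1e «VALENCIES OF THE `U(3)` LATTICE TREE», FILE V4 = THE ASSEMBLY: the `(q³+1, q+1)`-bi-regularity in the plug shape of ★ `TreeDisplacementLayerCount` ED. 2, and the sphere
counts around a vertex; 2026-09-01.  Sequel of ★ V2b `UnitaryLatticeTreeRootStarCount` and ★ V3 `UnitaryLatticeTreeTypeTwoStarCount`.
-/
import Literature.NumberTheory.Automorphic.UnitaryLatticeTreeRootStarCount      -- ★ T1e V2b (B-p14 (g36)): `ncard_neighborSet_of_isSelfDualLattice` (`q³ + 1`), `finite_…`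
import Literature.NumberTheory.Automorphic.UnitaryLatticeTreeTypeTwoStarCount   -- ★ T1e V3 (B-p14 (g36)): `ncard_neighborSet_of_isVertexLattice_two` (`q + 1`), `finite_…`
import Literature.Combinatorics.SimpleGraph.TreeDisplacementLayerCount          -- ★ (F0P3a-p08 (g17)) ED. 2: `ncard_sphere_eq_of_biregular'` (the `hnb` ∕ `ncard`-valency plug shape)
import HarnessLib

/-!
# The lattice graph of a hermitian space — T1e FILE V4: THE BRUHAT–TITS TREE OF THE UNRAMIFIED `U(3)` IS `(q³+1, q+1)`-BI-REGULAR (assembly in the plug shape of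
# ★ `TreeDisplacementLayerCount` ED. 2) and its spheres: `#S_m(L) = (q³+1)·q^{⌊m∕2⌋}·q^{3⌊(m−1)∕2⌋}` around a hyperspecial vertex (Bruhat–Tits 1972 §10; Tits 1979 §2.4; Serre II.1.1)

Topic `NumberTheory/Automorphic`; namespace `Literature.NumberTheory.Automorphic.UnitaryLatticeTree`.  THEOREMS ONLY (no definition, no instance, no notation, no named fact,
no `sorry`); kernel lane.  Cell `pub/hodgecm-mathlib` (D-0151), crux H413 = `stmt-HodgeConjecture-24833`; road «S3-tree», brick **T1e «VALENCIES»** — the ASSEMBLY of ★ V1–V3 in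
EXACTLY the hypothesis shape of the T2-S fold's tree organs (★ F0P3a-p08 (g17) `TreeDisplacementLayerCount` ED. 2 ∕ ★ `TreeLayers.ncard_layer_succ_inter_type_eq`):
`hnb : ∀ v, (G.neighborSet v).Finite`, a type function `c : V → Fin 2` with `hc : G.Adj v w → c v ≠ c w`, and `hdeg : ∀ v, (G.neighborSet v).ncard = q (c v) + 1` with
`q = ![q³, q]` — here for `G = latticeGraph σ ϖ J₀`, the Bruhat–Tits tree of the unramified `U(3)` in the T1a lattice model (★ `isTree_latticeGraph_three_of_unramified`).

THE MATHEMATICS (`hd : UnramifiedLocalConjDatum σ ϖ`; the residual involution in the cell's currency: `hσO`, `σk`, `hσk`, `Fintype.card 𝓀 = q²`, `σk y = y^q`).  Every vertex is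
self-dual (type `0`) or of type `2` and not both (★ V1); a TYPE FUNCTION is any `c : V → Fin 2` with `c v = 0 ↔ v` self-dual (one exists, §1); along an edge the types differ
(★ V1 `isSelfDualLattice_iff_not_isSelfDualLattice_of_adj`), every star is finite (★ V2b ∕ V3), and `#star(v) = q³ + 1` (type `0`, ★ V2b) resp. `q + 1` (type `2`, ★ V3) — i.e.
`(G.neighborSet v).ncard = ![q³, q] (c v) + 1` (§2).  Feeding ★ `TreeDisplacement.ncard_sphere_eq_of_biregular'` (§3): around a self-dual vertex `L`, for `m ≥ 1`,
`#{v | dist(L, v) = m} = (q³ + 1) · q^{⌊m∕2⌋} · (q³)^{⌊(m−1)∕2⌋}` (`q³+1` type-two neighbours, `(q³+1)q` hyperspecial vertices at distance `2` = the `q⁴ + q` Hecke neighbours of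
★ `HyperspecialUnitaryRankOneHeckeNeighbours` — the S3-T0 KILL-CHECK 1, now a theorem of the lattice model), and around a type-two vertex `#{v | dist = m} = (q + 1) · (q³)^{⌊m∕2⌋} · q^{⌊(m−1)∕2⌋}`.

* §1 `isVertexLattice_two_of_not_isSelfDualLattice`, `exists_typeFun` (a type function exists), **`typeFun_ne_of_adj`** (`hc`), `typeFun_eq_zero_iff` ∕ `typeFun_eq_one_iff`.
* §2 **`finite_neighborSet`** (`hnb`, any vertex, finite residue field), **`ncard_neighborSet_eq_typeFun`** (`hdeg` with `q = ![q³, q]`).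
* §3 **`ncard_sphere_of_isSelfDualLattice`**, `ncard_sphere_two_of_isSelfDualLattice` (`= q⁴ + q`), **`ncard_sphere_of_isVertexLattice_two`** — the spheres of the `U(3)` tree.

HONEST LABEL: HC_CM is proved only modulo the 2 remaining named inputs (hLiu418 24832, h413 24833) until rung 0 closes; nothing printed is asserted here (elementary lattice
algebra over a valuation ring, a finite-field count and tree combinatorics); S3 (`stub_N6nsS3id`) stays a print row until the road's END lands.

## References
* [BruhatTits1972] F. Bruhat, J. Tits, *Groupes réductifs sur un corps local I*, Publ. Math. IHÉS 41 (1972), §10 (the tree of a rank-one group).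
* [Tits1979] J. Tits, *Reductive groups over local fields*, PSPM 33.1 (1979), §2.4 (quasi-split `U(3)`: local index `(q³+1, q+1)`), §3.5 (stars = residual buildings).
* [Serre1980Trees] J.-P. Serre, *Trees* (1980), Ch. II §1.1 (`(q+1)q^{m−1}` vertices at distance `m` in the tree of `SL₂`; the bi-regular analogue here), Ch. I §2.3.
-/

set_option autoImplicit false

noncomputable section

open scoped Valued WithZero Matrix MatrixGroups

namespace Literature.NumberTheory.Automorphic.UnitaryLatticeTree

open Literature.NumberTheory.Automorphic Literature.NumberTheory.Automorphic.HermitianLattice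
open Literature.NumberTheory.Automorphic.CartanUnique Literature.Combinatorics.SimpleGraph

variable {K : Type*} [Field K] [Valued K ℤᵐ⁰] {σ : K →+* K} {ϖ : K}

/-! ## §1 Type functions -/

/-- A vertex that is not self-dual is of type `2` (types are `0` or `2` at `N = 3`). [cite: BruhatTits1972, §10] [cite: Tits1979, §2.4] -/
theorem isVertexLattice_two_of_not_isSelfDualLattice (hd : UnramifiedLocalConjDatum σ ϖ)
    (v : {M : Submodule 𝒪[K] (Fin 3 → K) // IsVertex σ ϖ ((StdForm.antidiagonal 3).over K) M})
    (hv : ¬ IsSelfDualLattice σ ϖ ((StdForm.antidiagonal 3).over K) v.1) : IsVertexLattice σ ϖ ((StdForm.antidiagonal 3).over K) 2 v.1 := by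
  obtain ⟨d, hdv⟩ := v.2
  rcases type_eq_zero_or_two_of_isVertexLattice_three hd.vσ hd.vϖ v_det_antidiagonal_three hdv with rfl | rfl
  · exact absurd hdv hv
  · exact hdv

/-- **A type function exists**: some `c : V → Fin 2` has `c v = 0 ↔ v` self-dual (classically, `c v := if v.1 is self-dual then 0 else 1`). [cite: BruhatTits1972, §10] -/
theorem exists_typeFun :
    ∃ c : {M : Submodule 𝒪[K] (Fin 3 → K) // IsVertex σ ϖ ((StdForm.antidiagonal 3).over K) M} → Fin 2,
      ∀ v, c v = 0 ↔ IsSelfDualLattice σ ϖ ((StdForm.antidiagonal 3).over K) v.1 := by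
  classical
  refine ⟨fun v => if IsSelfDualLattice σ ϖ ((StdForm.antidiagonal 3).over K) v.1 then 0 else 1, fun v => ?_⟩
  by_cases h : IsSelfDualLattice σ ϖ ((StdForm.antidiagonal 3).over K) v.1
  · simp [h]
  · simp [h]

/-- For a type function: `c v = 1 ↔ v` is not self-dual (`Fin 2` has two elements). [cite: BruhatTits1972, §10] -/
theorem typeFun_eq_one_iff {c : {M : Submodule 𝒪[K] (Fin 3 → K) // IsVertex σ ϖ ((StdForm.antidiagonal 3).over K) M} → Fin 2}
    (hc0 : ∀ v, c v = 0 ↔ IsSelfDualLattice σ ϖ ((StdForm.antidiagonal 3).over K) v.1)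
    (v : {M : Submodule 𝒪[K] (Fin 3 → K) // IsVertex σ ϖ ((StdForm.antidiagonal 3).over K) M}) :
    c v = 1 ↔ ¬ IsSelfDualLattice σ ϖ ((StdForm.antidiagonal 3).over K) v.1 := by
  rw [← hc0 v]
  constructor
  · intro h h0; rw [h0] at h; exact absurd h (by decide)
  · intro h; exact Fin.eq_one_of_ne_zero (c v) h

/-- **TYPES DIFFER ALONG EDGES** — the hypothesis `hc : ∀ v w, G.Adj v w → c v ≠ c w` of ★ `TreeLayers` ∕ ★ `TreeDisplacementLayerCount` for any type function of the `U(3)` tree.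
[cite: BruhatTits1972, §10] [cite: Serre1980Trees, I.2.3] -/
theorem typeFun_ne_of_adj (hd : UnramifiedLocalConjDatum σ ϖ)
    {c : {M : Submodule 𝒪[K] (Fin 3 → K) // IsVertex σ ϖ ((StdForm.antidiagonal 3).over K) M} → Fin 2}
    (hc0 : ∀ v, c v = 0 ↔ IsSelfDualLattice σ ϖ ((StdForm.antidiagonal 3).over K) v.1) :
    ∀ v w, (latticeGraph σ ϖ ((StdForm.antidiagonal 3).over K)).Adj v w → c v ≠ c w := by
  intro v w h hEq
  have halt := isSelfDualLattice_iff_not_isSelfDualLattice_of_adj hd h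
  by_cases hv : IsSelfDualLattice σ ϖ ((StdForm.antidiagonal 3).over K) v.1
  · exact (halt.1 hv) ((hc0 w).1 (hEq ▸ (hc0 v).2 hv))
  · have hw : IsSelfDualLattice σ ϖ ((StdForm.antidiagonal 3).over K) w.1 := by
      by_contra hw; exact hv (halt.2 hw)
    exact hv ((hc0 v).1 (hEq ▸ (hc0 w).2 hw))

/-! ## §2 The bi-regularity `(q³ + 1, q + 1)` in the `hnb` ∕ `ncard` plug shape -/

/-- **EVERY STAR IS FINITE** — the hypothesis `hnb : ∀ v, (G.neighborSet v).Finite` of ★ `TreeDisplacementLayerCount` ED. 2 for the `U(3)` lattice tree (finite residue field; any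
reduction `σk` of `σ`). [cite: BruhatTits1972, §10] [cite: Serre1980Trees, II.1.1] -/
theorem finite_neighborSet (hd : UnramifiedLocalConjDatum σ ϖ) (hσO : ∀ x : 𝒪[K], σ x ∈ 𝒪[K]) (σk : 𝓀[K] →+* 𝓀[K])
    (hσk : ∀ x : 𝒪[K], IsLocalRing.residue 𝒪[K] ⟨σ x, hσO x⟩ = σk (IsLocalRing.residue 𝒪[K] x)) [Finite 𝓀[K]]
    (v : {M : Submodule 𝒪[K] (Fin 3 → K) // IsVertex σ ϖ ((StdForm.antidiagonal 3).over K) M}) :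
    ((latticeGraph σ ϖ ((StdForm.antidiagonal 3).over K)).neighborSet v).Finite := by
  by_cases hv : IsSelfDualLattice σ ϖ ((StdForm.antidiagonal 3).over K) v.1
  · exact finite_neighborSet_of_isSelfDualLattice hd hσO σk hσk v hv
  · exact finite_neighborSet_of_isVertexLattice_two hd hσO σk hσk v (isVertexLattice_two_of_not_isSelfDualLattice hd v hv)

/-- **THE `U(3)` LATTICE TREE IS `(q³+1, q+1)`-BI-REGULAR** — the hypothesis `hdeg : ∀ v, (G.neighborSet v).ncard = q (c v) + 1` of ★ `TreeDisplacementLayerCount` ED. 2 with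
`q = ![q³, q]`, for ANY type function `c` (`c v = 0 ↔ v` self-dual); `|𝓀| = q²`, `σk` the `q`-Frobenius. [cite: Tits1979, §2.4] [cite: BruhatTits1972, §10] [cite: Serre1980Trees, II.1.1] -/
theorem ncard_neighborSet_eq_typeFun (hd : UnramifiedLocalConjDatum σ ϖ) (hσO : ∀ x : 𝒪[K], σ x ∈ 𝒪[K]) (σk : 𝓀[K] →+* 𝓀[K])
    (hσk : ∀ x : 𝒪[K], IsLocalRing.residue 𝒪[K] ⟨σ x, hσO x⟩ = σk (IsLocalRing.residue 𝒪[K] x))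
    [Fintype 𝓀[K]] {q : ℕ} (hk : Fintype.card 𝓀[K] = q ^ 2) (hfrob : ∀ y, σk y = y ^ q)
    {c : {M : Submodule 𝒪[K] (Fin 3 → K) // IsVertex σ ϖ ((StdForm.antidiagonal 3).over K) M} → Fin 2}
    (hc0 : ∀ v, c v = 0 ↔ IsSelfDualLattice σ ϖ ((StdForm.antidiagonal 3).over K) v.1)
    (v : {M : Submodule 𝒪[K] (Fin 3 → K) // IsVertex σ ϖ ((StdForm.antidiagonal 3).over K) M}) :
    ((latticeGraph σ ϖ ((StdForm.antidiagonal 3).over K)).neighborSet v).ncard = (![q ^ 3, q] : Fin 2 → ℕ) (c v) + 1 := by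
  by_cases hv : IsSelfDualLattice σ ϖ ((StdForm.antidiagonal 3).over K) v.1
  · rw [(hc0 v).2 hv, ncard_neighborSet_of_isSelfDualLattice hd hσO σk hσk hk hfrob v hv]; rfl
  · rw [(typeFun_eq_one_iff hc0 v).2 hv,
      ncard_neighborSet_of_isVertexLattice_two hd hσO σk hσk hk hfrob v (isVertexLattice_two_of_not_isSelfDualLattice hd v hv)]; rfl

/-! ## §3 The spheres of the `U(3)` tree around a vertex -/

/-- **THE SPHERES AROUND A HYPERSPECIAL VERTEX**: for a self-dual vertex `r` and `m ≥ 1`, `#{v | dist(r, v) = m} = (q³ + 1) · q^{⌊m∕2⌋} · (q³)^{⌊(m−1)∕2⌋}` (★ `isTree_latticeGraph_three_of_unramified`,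
★ `TreeDisplacement.ncard_sphere_eq_of_biregular'`, §2). [cite: Serre1980Trees, II.1.1] [cite: BruhatTits1972, §10] [cite: Tits1979, §2.4] -/
theorem ncard_sphere_of_isSelfDualLattice (hd : UnramifiedLocalConjDatum σ ϖ) (hσO : ∀ x : 𝒪[K], σ x ∈ 𝒪[K]) (σk : 𝓀[K] →+* 𝓀[K])
    (hσk : ∀ x : 𝒪[K], IsLocalRing.residue 𝒪[K] ⟨σ x, hσO x⟩ = σk (IsLocalRing.residue 𝒪[K] x))
    [Fintype 𝓀[K]] {q : ℕ} (hk : Fintype.card 𝓀[K] = q ^ 2) (hfrob : ∀ y, σk y = y ^ q)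
    (r : {M : Submodule 𝒪[K] (Fin 3 → K) // IsVertex σ ϖ ((StdForm.antidiagonal 3).over K) M}) (hr : IsSelfDualLattice σ ϖ ((StdForm.antidiagonal 3).over K) r.1)
    {m : ℕ} (hm : 1 ≤ m) :
    {v | (latticeGraph σ ϖ ((StdForm.antidiagonal 3).over K)).dist r v = m}.ncard = (q ^ 3 + 1) * q ^ (m / 2) * (q ^ 3) ^ ((m - 1) / 2) := by
  obtain ⟨c, hc0⟩ := exists_typeFun (K := K) (σ := σ) (ϖ := ϖ)
  have h := TreeDisplacement.ncard_sphere_eq_of_biregular' (isTree_latticeGraph_three_of_unramified hd) (finite_neighborSet hd hσO σk hσk) r c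
    (typeFun_ne_of_adj hd hc0) ![q ^ 3, q] (ncard_neighborSet_eq_typeFun hd hσO σk hσk hk hfrob hc0) ((hc0 r).2 hr) Fin.zero_ne_one hm
  simpa using h

/-- **`q⁴ + q` HYPERSPECIAL VERTICES AT DISTANCE `2`** from a hyperspecial vertex — the `q⁴ + q` Hecke neighbours `K₀tK₀ ∕ K₀` of ★ `HyperspecialUnitaryRankOneHeckeNeighbours`, recovered
in the lattice model (S3-T0 KILL-CHECK 1). [cite: Serre1980Trees, II.1.1] [cite: Tits1979, §2.4] -/
theorem ncard_sphere_two_of_isSelfDualLattice (hd : UnramifiedLocalConjDatum σ ϖ) (hσO : ∀ x : 𝒪[K], σ x ∈ 𝒪[K]) (σk : 𝓀[K] →+* 𝓀[K])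
    (hσk : ∀ x : 𝒪[K], IsLocalRing.residue 𝒪[K] ⟨σ x, hσO x⟩ = σk (IsLocalRing.residue 𝒪[K] x))
    [Fintype 𝓀[K]] {q : ℕ} (hk : Fintype.card 𝓀[K] = q ^ 2) (hfrob : ∀ y, σk y = y ^ q)
    (r : {M : Submodule 𝒪[K] (Fin 3 → K) // IsVertex σ ϖ ((StdForm.antidiagonal 3).over K) M}) (hr : IsSelfDualLattice σ ϖ ((StdForm.antidiagonal 3).over K) r.1) :
    {v | (latticeGraph σ ϖ ((StdForm.antidiagonal 3).over K)).dist r v = 2}.ncard = q ^ 4 + q := by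
  rw [ncard_sphere_of_isSelfDualLattice hd hσO σk hσk hk hfrob r hr (by norm_num : 1 ≤ 2)]
  norm_num
  ring

/-- **THE SPHERES AROUND A TYPE-TWO VERTEX**: for `r` of type `2` and `m ≥ 1`, `#{v | dist(r, v) = m} = (q + 1) · (q³)^{⌊m∕2⌋} · q^{⌊(m−1)∕2⌋}`.
[cite: Serre1980Trees, II.1.1] [cite: BruhatTits1972, §10] [cite: Tits1979, §2.4] -/
theorem ncard_sphere_of_isVertexLattice_two (hd : UnramifiedLocalConjDatum σ ϖ) (hσO : ∀ x : 𝒪[K], σ x ∈ 𝒪[K]) (σk : 𝓀[K] →+* 𝓀[K])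
    (hσk : ∀ x : 𝒪[K], IsLocalRing.residue 𝒪[K] ⟨σ x, hσO x⟩ = σk (IsLocalRing.residue 𝒪[K] x))
    [Fintype 𝓀[K]] {q : ℕ} (hk : Fintype.card 𝓀[K] = q ^ 2) (hfrob : ∀ y, σk y = y ^ q)
    (r : {M : Submodule 𝒪[K] (Fin 3 → K) // IsVertex σ ϖ ((StdForm.antidiagonal 3).over K) M}) (hr : IsVertexLattice σ ϖ ((StdForm.antidiagonal 3).over K) 2 r.1)
    {m : ℕ} (hm : 1 ≤ m) :
    {v | (latticeGraph σ ϖ ((StdForm.antidiagonal 3).over K)).dist r v = m}.ncard = (q + 1) * (q ^ 3) ^ (m / 2) * q ^ ((m - 1) / 2) := by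
  obtain ⟨c, hc0⟩ := exists_typeFun (K := K) (σ := σ) (ϖ := ϖ)
  have hr1 : c r = 1 := (typeFun_eq_one_iff hc0 r).2 (not_isSelfDualLattice_of_isVertexLattice_two hd hr)
  have h := TreeDisplacement.ncard_sphere_eq_of_biregular' (isTree_latticeGraph_three_of_unramified hd) (finite_neighborSet hd hσO σk hσk) r c
    (typeFun_ne_of_adj hd hc0) ![q ^ 3, q] (ncard_neighborSet_eq_typeFun hd hσO σk hσk hk hfrob hc0) hr1 Fin.zero_ne_one.symm hm
  simpa using h

end Literature.NumberTheory.Automorphic.UnitaryLatticeTree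

end
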